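import Mathlib.Analysis.SpecialFunctions.Pow.Real
import Mathlib.Tactic.FieldSimp
import Mathlib.Tactic.LinearCombination
import HarnessLib

/-!
# `KerrShieldedDataExist`, line `plug-the-second-sheet` (skeleton v4 "KerrCap") — stub `stub_capFarH`, I:
# the scalar algebra of the far-zone induced metric of the cap map

Support file (`--supports stmt-FinalStateConjecture-10055`; everything proved, no definitions, no named facts)
for the registered stub `stub_capFarH` of `Cruxes/KerrShieldedDataExist/Lines/plug_the_second_sheet.lean`.

On the far zone `s = ‖u‖ ≥ σ₅` the cap map is `Φ(u) = (τ(s), X u)`, `X u = L_{r} Rot_z(α) (u/s)` with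
`r = ϱ(s) = s + M + (M² − a²)/4s` (quasi-isotropic Boyer–Lindquist radius), `τ = T_{M,a}(r) + c`
(`T′ = 2Mr/Δ`) and `α = χ(r)`, `χ′ = a/Δ`. Writing `p = Rot_z(α) u = (P, Q, u₂)`, `q = Rot_z(α) v`, the
differential of `X` (`KerrCap.fderiv_capMap_apply`) is `DX v = (1/s) L q + (⟪u,v⟫/s)(−L p/s² + ϱ′ p/s + α′ L(ẑ × p)/s)`,
`L y = r y + a ẑ × y`; the Kerr–Schild data at `X u` are `ℓ⃗ = p/s`, `H = M r s²/(r²s² + a²u₂²)`. This file carries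
out the three purely algebraic steps of the computation of `g(DΦ v, DΦ w)`, `g = η + 2Hℓ ⊗ ℓ`, over `ℝ`:

* `KerrCap.capFar_ell` — the contraction `⟪p, DX v⟫ = ϱ′⟪u,v⟫ − aω(v)/s − α′a(s² − u₂²)⟪u,v⟫/s²`,
  `ω(v) = u₀v₁ − u₁v₀` (uses only `⟪p, q⟫ = ⟪u, v⟫`, `(p × q)₃ = ω(v)`, `‖p‖ = s`);
* `KerrCap.capFar_flat` — the flat part `⟪DX v, DX w⟫` in the rotation-invariant atoms
  `⟪u,v⟫, ⟪u,w⟫, ⟪v,w⟫, ω(v), ω(w), u₂, v₂, w₂, s`;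
* `KerrCap.capFar_atoms` — **the far-zone identity**: with `r, ϱ′, τ′ = T′(r)ϱ′, α′ = χ′(r)ϱ′` as above,
  `−τ′²σ_vσ_w + ⟪DXv, DXw⟫ + 2H ℓ(DΦv)ℓ(DΦw) = (Σ/s²)⟪v,w⟫ + a²(r² + 2Mr + a²μ²)/(Σs⁴) ω(v)ω(w)`,
  `Σ = r² + a²μ²`, `μ = u₂/s` — the Boyer–Lindquist slice metric `Σ/Δ dr² + Σ dθ² + (A/Σ) sin²θ dφ²` read in
  quasi-isotropic Cartesian coordinates (`Σ/Δ · ϱ′² = Σ/s²`); the one relation among the atoms that enters is the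
  planar Lagrange identity `ω(v)ω(w) = (s² − u₂²)(⟪v,w⟫ − v₂w₂) − (⟪u,v⟫ − u₂v₂)(⟪u,w⟫ − u₂w₂)`.

References: Brandt–Seidel, PRD 54 (1996) 1403, §II (quasi-isotropic radial coordinate of Kerr); Visser
arXiv:0706.0622, (32)–(36); Bardeen–Press–Teukolsky 1972, (2.1)–(2.2) (Boyer–Lindquist form).
-/

-- the doubled `FinalStateConjecture` path component is the summit/problem naming scheme, not a mistake
set_option linter.dupNamespace false

noncomputable section

namespace Summit.FinalStateConjecture.FinalStateConjecture.Theorems.SwallowTheDatum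

namespace KerrCap

/-- **The `ℓ`-contraction of the differential of the cap map.** With the components `X₀, X₁, X₂` of `DX(u) v`
(`KerrCap.fderiv_capMap_apply`, `p = (P, Q, u₂)`, `q = (P_v, Q_v, v₂)`, `iv = ⟪u, v⟫`) and the rotation
identities `⟪p, q⟫ = iv`, `PQ_v − QP_v = ω(v)`, `‖p‖² = s²`:
`P X₀ + Q X₁ + u₂ X₂ = (s²r·iv − s²a·ω(v) + iv((sϱ′ − r)s² − sα′a(s² − u₂²)))/s³`. [folklore] -/
theorem capFar_ell {P Q u2 Pv Qv v2 iv ωv s r dϱ dα a X0 X1 X2 : ℝ} (hs : s ≠ 0)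
    (hX0 : X0 = (r * Pv - a * Qv) / s +
      iv * ((dϱ * P - dα * (r * Q + a * P)) / s ^ 2 - (r * P - a * Q) / s ^ 3))
    (hX1 : X1 = (r * Qv + a * Pv) / s +
      iv * ((dϱ * Q + dα * (r * P - a * Q)) / s ^ 2 - (r * Q + a * P) / s ^ 3))
    (hX2 : X2 = r * v2 / s + iv * (dϱ * u2 / s ^ 2 - r * u2 / s ^ 3))
    (hj : P * Pv + Q * Qv + u2 * v2 = iv) (hω : P * Qv - Q * Pv = ωv) (hρ : P ^ 2 + Q ^ 2 + u2 ^ 2 = s ^ 2) :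
    P * X0 + Q * X1 + u2 * X2 =
      (s ^ 2 * r * iv - s ^ 2 * a * ωv + iv * ((s * dϱ - r) * s ^ 2 - s * dα * a * (s ^ 2 - u2 ^ 2))) / s ^ 3 := by
  have key : s ^ 3 * (P * X0 + Q * X1 + u2 * X2) =
      s ^ 2 * r * (P * Pv + Q * Qv + u2 * v2) - s ^ 2 * a * (P * Qv - Q * Pv) +
        iv * ((s * dϱ - r) * (P ^ 2 + Q ^ 2 + u2 ^ 2) - s * dα * a * (P ^ 2 + Q ^ 2 + u2 ^ 2 - u2 ^ 2)) := by
    rw [hX0, hX1, hX2]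
    field_simp
    ring
  rw [hj, hω, hρ] at key
  rw [eq_div_iff (pow_ne_zero 3 hs)]
  linear_combination key

/-- **The flat part `⟪DX v, DX w⟫` of the induced metric of the cap map**, in rotation-invariant atoms: with
`DX v = (1/s)Lq + (iv/s)B`, `B = −Lp/s² + ϱ′p/s + α′L(ẑ×p)/s`, `L y = r y + a ẑ × y`, one has
`⟪Ly, Ly'⟫ = (r² + a²)⟪y, y'⟫ − a²y₂y₂'`, `⟪Lq, p⟫ = r⟪p,q⟫ − aω`, `⟪Lq, L(ẑ×p)⟫ = (r²+a²)ω`,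
`⟪Lp, L(ẑ×p)⟫ = 0`, `⟪p, L(ẑ×p)⟫ = −a(P² + Q²)`, whence the stated closed form. [folklore] -/
theorem capFar_flat {P Q u2 Pv Qv v2 Pw Qw w2 iv iw ivw ωv ωw s r dϱ dα a X0v X1v X2v X0w X1w X2w : ℝ}
    (hs : s ≠ 0)
    (hX0v : X0v = (r * Pv - a * Qv) / s +
      iv * ((dϱ * P - dα * (r * Q + a * P)) / s ^ 2 - (r * P - a * Q) / s ^ 3))
    (hX1v : X1v = (r * Qv + a * Pv) / s +
      iv * ((dϱ * Q + dα * (r * P - a * Q)) / s ^ 2 - (r * Q + a * P) / s ^ 3))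
    (hX2v : X2v = r * v2 / s + iv * (dϱ * u2 / s ^ 2 - r * u2 / s ^ 3))
    (hX0w : X0w = (r * Pw - a * Qw) / s +
      iw * ((dϱ * P - dα * (r * Q + a * P)) / s ^ 2 - (r * P - a * Q) / s ^ 3))
    (hX1w : X1w = (r * Qw + a * Pw) / s +
      iw * ((dϱ * Q + dα * (r * P - a * Q)) / s ^ 2 - (r * Q + a * P) / s ^ 3))
    (hX2w : X2w = r * w2 / s + iw * (dϱ * u2 / s ^ 2 - r * u2 / s ^ 3))
    (hjv : P * Pv + Q * Qv + u2 * v2 = iv) (hjw : P * Pw + Q * Qw + u2 * w2 = iw)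
    (hjvw : Pv * Pw + Qv * Qw + v2 * w2 = ivw)
    (hωv : P * Qv - Q * Pv = ωv) (hωw : P * Qw - Q * Pw = ωw) (hρ : P ^ 2 + Q ^ 2 + u2 ^ 2 = s ^ 2) :
    X0v * X0w + X1v * X1w + X2v * X2w =
      (s ^ 4 * ((r ^ 2 + a ^ 2) * (ivw - v2 * w2) + r ^ 2 * v2 * w2) +
        iw * s ^ 2 * (-((r ^ 2 + a ^ 2) * (iv - u2 * v2) + r ^ 2 * u2 * v2) + s * dϱ * (r * iv - a * ωv) +
          s * dα * (r ^ 2 + a ^ 2) * ωv) +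
        iv * s ^ 2 * (-((r ^ 2 + a ^ 2) * (iw - u2 * w2) + r ^ 2 * u2 * w2) + s * dϱ * (r * iw - a * ωw) +
          s * dα * (r ^ 2 + a ^ 2) * ωw) +
        iv * iw * ((r ^ 2 + a ^ 2) * (s ^ 2 - u2 ^ 2) + r ^ 2 * u2 ^ 2 + dϱ ^ 2 * s ^ 2 * s ^ 2 +
          dα ^ 2 * s ^ 2 * (r ^ 2 + a ^ 2) * (s ^ 2 - u2 ^ 2) - 2 * dϱ * s * r * s ^ 2 -
          2 * dϱ * dα * s ^ 2 * a * (s ^ 2 - u2 ^ 2))) / s ^ 6 := by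
  have key : s ^ 6 * (X0v * X0w + X1v * X1w + X2v * X2w) =
      s ^ 4 * ((r ^ 2 + a ^ 2) * (Pv * Pw + Qv * Qw + v2 * w2 - v2 * w2) + r ^ 2 * v2 * w2) +
        iw * s ^ 2 * (-((r ^ 2 + a ^ 2) * (P * Pv + Q * Qv + u2 * v2 - u2 * v2) + r ^ 2 * u2 * v2) +
          s * dϱ * (r * (P * Pv + Q * Qv + u2 * v2) - a * (P * Qv - Q * Pv)) +
          s * dα * (r ^ 2 + a ^ 2) * (P * Qv - Q * Pv)) +
        iv * s ^ 2 * (-((r ^ 2 + a ^ 2) * (P * Pw + Q * Qw + u2 * w2 - u2 * w2) + r ^ 2 * u2 * w2) +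
          s * dϱ * (r * (P * Pw + Q * Qw + u2 * w2) - a * (P * Qw - Q * Pw)) +
          s * dα * (r ^ 2 + a ^ 2) * (P * Qw - Q * Pw)) +
        iv * iw * ((r ^ 2 + a ^ 2) * (P ^ 2 + Q ^ 2 + u2 ^ 2 - u2 ^ 2) + r ^ 2 * u2 ^ 2 +
          dϱ ^ 2 * s ^ 2 * (P ^ 2 + Q ^ 2 + u2 ^ 2) +
          dα ^ 2 * s ^ 2 * (r ^ 2 + a ^ 2) * (P ^ 2 + Q ^ 2 + u2 ^ 2 - u2 ^ 2) -
          2 * dϱ * s * r * (P ^ 2 + Q ^ 2 + u2 ^ 2) -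
          2 * dϱ * dα * s ^ 2 * a * (P ^ 2 + Q ^ 2 + u2 ^ 2 - u2 ^ 2)) := by
    rw [hX0v, hX1v, hX2v, hX0w, hX1w, hX2w]
    field_simp
    ring
  rw [hjv, hjw, hjvw, hωv, hωw, hρ] at key
  rw [eq_div_iff (pow_ne_zero 6 hs)]
  linear_combination key

/-- **The far-zone identity in rotation-invariant atoms** (the heart of `stub_capFarH`): for
`r = s + M + (M² − a²)/4s`, `ϱ′ = 1 − (M² − a²)/4s²`, `τ′ = (2Mr/Δ)ϱ′`, `α′ = (a/Δ)ϱ′` (`Δ = r² − 2Mr + a²`, which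
equals `(sϱ′)²`), the Kerr–Schild form `−τ′²σ_vσ_w + ⟪DXv, DXw⟫ + 2H(τ′σ_v + ⟪ℓ⃗, DXv⟫)(τ′σ_w + ⟪ℓ⃗, DXw⟫)`
(`σ_v = iv/s`, `H = Mrs²/(r²s² + a²u₂²)`, the flat part and the `ℓ`-contractions as in `capFar_flat`,
`capFar_ell`) equals `(r²s² + a²u₂²)/s⁴ · ivw + a²(r²s² + 2Mrs² + a²u₂²)/((r²s² + a²u₂²)s⁴) · ω_v ω_w`, given the
planar Lagrange identity among the atoms. This is the Boyer–Lindquist slice metric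
`h = Σ/Δ dr² + Σ dθ² + ((r²+a²)² − Δa²sin²θ)/Σ · sin²θ dφ²` in the quasi-isotropic Cartesian coordinates
`u = s n̂(θ, φ)` of Brandt–Seidel. [cite: BrandtSeidel1996, §II] -/
theorem capFar_atoms {s M a u2 v2 w2 iv iw ivw ωv ωw r dϱ dτ dα : ℝ} (hs : s ≠ 0)
    (hr : r = s + M + (M ^ 2 - a ^ 2) / (4 * s)) (hdϱ : dϱ = 1 - (M ^ 2 - a ^ 2) / (4 * s ^ 2))
    (hdτ : dτ = 2 * M * r / (r ^ 2 - 2 * M * r + a ^ 2) * dϱ)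
    (hdα : dα = a / (r ^ 2 - 2 * M * r + a ^ 2) * dϱ)
    (hΔ : r ^ 2 - 2 * M * r + a ^ 2 ≠ 0) (hS : r ^ 2 * s ^ 2 + a ^ 2 * u2 ^ 2 ≠ 0)
    (hL : ωv * ωw = (s ^ 2 - u2 ^ 2) * (ivw - v2 * w2) - (iv - u2 * v2) * (iw - u2 * w2)) :
    -(dτ * s⁻¹ * iv * (dτ * s⁻¹ * iw)) +
      (s ^ 4 * ((r ^ 2 + a ^ 2) * (ivw - v2 * w2) + r ^ 2 * v2 * w2) +
        iw * s ^ 2 * (-((r ^ 2 + a ^ 2) * (iv - u2 * v2) + r ^ 2 * u2 * v2) + s * dϱ * (r * iv - a * ωv) +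
          s * dα * (r ^ 2 + a ^ 2) * ωv) +
        iv * s ^ 2 * (-((r ^ 2 + a ^ 2) * (iw - u2 * w2) + r ^ 2 * u2 * w2) + s * dϱ * (r * iw - a * ωw) +
          s * dα * (r ^ 2 + a ^ 2) * ωw) +
        iv * iw * ((r ^ 2 + a ^ 2) * (s ^ 2 - u2 ^ 2) + r ^ 2 * u2 ^ 2 + dϱ ^ 2 * s ^ 2 * s ^ 2 +
          dα ^ 2 * s ^ 2 * (r ^ 2 + a ^ 2) * (s ^ 2 - u2 ^ 2) - 2 * dϱ * s * r * s ^ 2 -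
          2 * dϱ * dα * s ^ 2 * a * (s ^ 2 - u2 ^ 2))) / s ^ 6 +
      2 * (M * r * s ^ 2 / (r ^ 2 * s ^ 2 + a ^ 2 * u2 ^ 2)) *
        ((dτ * s⁻¹ * iv + s⁻¹ * ((s ^ 2 * r * iv - s ^ 2 * a * ωv +
            iv * ((s * dϱ - r) * s ^ 2 - s * dα * a * (s ^ 2 - u2 ^ 2))) / s ^ 3)) *
         (dτ * s⁻¹ * iw + s⁻¹ * ((s ^ 2 * r * iw - s ^ 2 * a * ωw +
            iw * ((s * dϱ - r) * s ^ 2 - s * dα * a * (s ^ 2 - u2 ^ 2))) / s ^ 3))) =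
      (r ^ 2 * s ^ 2 + a ^ 2 * u2 ^ 2) / s ^ 4 * ivw +
        a ^ 2 * (r ^ 2 * s ^ 2 + 2 * M * r * s ^ 2 + a ^ 2 * u2 ^ 2) / ((r ^ 2 * s ^ 2 + a ^ 2 * u2 ^ 2) * s ^ 4) *
          (ωv * ωw) := by
  -- `Δ(r) = (sϱ′)²` along the quasi-isotropic radius
  have hΔ' : r ^ 2 - 2 * M * r + a ^ 2 = (s * dϱ) ^ 2 := by rw [hr, hdϱ]; field_simp; ring
  have hsd : s * dϱ ≠ 0 := fun h ↦ hΔ (by rw [hΔ', h]; ring)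
  have hdϱ0 : dϱ ≠ 0 := fun h ↦ hsd (by rw [h, mul_zero])
  rw [hΔ'] at hdτ hdα
  subst hdτ hdα
  -- the single relation among the atoms enters with the coefficient `−a²/s⁴`
  linear_combination (norm := skip) (-(a ^ 2 / s ^ 4)) * hL
  field_simp
  rw [hr, hdϱ]
  field_simp
  ring

end KerrCap

/-- **Registered export of this file** (sub-goal `cap_farAtoms` of stub `stub_capFarH`): the far-zone identity in
rotation-invariant atoms, `KerrCap.capFar_atoms`. [cite: BrandtSeidel1996, §II] -/
theorem cap_farAtoms : ∀ {s M a u2 v2 w2 iv iw ivw ωv ωw r dϱ dτ dα : ℝ}, s ≠ 0 → r = s + M + (M ^ 2 - a ^ 2) / (4 * s) → dϱ = 1 - (M ^ 2 - a ^ 2) / (4 * s ^ 2) → dτ = 2 * M * r / (r ^ 2 - 2 * M * r + a ^ 2) * dϱ → dα = a / (r ^ 2 - 2 * M * r + a ^ 2) * dϱ → r ^ 2 - 2 * M * r + a ^ 2 ≠ 0 → r ^ 2 * s ^ 2 + a ^ 2 * u2 ^ 2 ≠ 0 → ωv * ωw = (s ^ 2 - u2 ^ 2) * (ivw - v2 *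 w2) - (iv - u2 * v2) * (iw - u2 * w2) → -(dτ * s⁻¹ * iv * (dτ * s⁻¹ * iw)) + (s ^ 4 * ((r ^ 2 + a ^ 2) * (ivw - v2 * w2) + r ^ 2 * v2 * w2) + iw * s ^ 2 * (-((r ^ 2 + a ^ 2) * (iv - u2 * v2) + r ^ 2 * u2 * v2) + s * dϱ * (r * iv - a * ωv) + s * dα * (r ^ 2 + a ^ 2) * ωv) + iv * s ^ 2 * (-((r ^ 2 + a ^ 2) * (iw - u2 * w2) + r ^ 2 * u2 * w2) + s * dϱ * (r * iw - a * ωw) + s * dα * (r ^ 2 + a ^ 2) * ωw) + iv * iw * ((r ^ 2 + a ^ 2) * (s ^ 2 - u2 ^ 2) + r ^ 2 * u2 ^ 2 + dϱ ^ 2 * s ^ 2 * s ^ 2 + dα ^ 2 * s ^ 2 * (r ^ 2 + a ^ 2) * (s ^ 2 - u2 ^ 2) - 2 * dϱ * s * r * s ^ 2 - 2 * dϱ * dα * s ^ 2 * a * (s ^ 2 - u2 ^ 2))) / s ^ 6 + 2 * (M * r * s ^ 2 / (r ^ 2 * s ^ 2 + a ^ 2 * u2 ^ 2)) * ((dτ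 * s⁻¹ * iv + s⁻¹ * ((s ^ 2 * r * iv - s ^ 2 * a * ωv + iv * ((s * dϱ - r) * s ^ 2 - s * dα * a * (s ^ 2 - u2 ^ 2))) / s ^ 3)) * (dτ * s⁻¹ * iw + s⁻¹ * ((s ^ 2 * r * iw - s ^ 2 * a * ωw + iw * ((s * dϱ - r) * s ^ 2 - s * dα * a * (s ^ 2 - u2 ^ 2))) / s ^ 3))) = (r ^ 2 * s ^ 2 + a ^ 2 * u2 ^ 2) / s ^ 4 * ivw + a ^ 2 * (r ^ 2 * s ^ 2 + 2 * M * r * s ^ 2 + a ^ 2 * u2 ^ 2) / ((r ^ 2 * s ^ 2 + a ^ 2 * u2 ^ 2) * s ^ 4) * (ωv * ωw) :=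
  fun hs hr hdϱ hdτ hdα hΔ hS hL ↦ KerrCap.capFar_atoms hs hr hdϱ hdτ hdα hΔ hS hL

end Summit.FinalStateConjecture.FinalStateConjecture.Theorems.SwallowTheDatum

end
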